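import Literature.AnabelianGeometry.SemiGraphs.TemperedLevelKernelCharOpenCore
import Literature.AnabelianGeometry.SemiGraphs.ThetaRayFreeProPQuasiCoherent
import Literature.AnabelianGeometry.SemiGraphs.FreeProPRankTwoLevels
import HarnessLib

/-!
# The (hK) binder of the escape at `𝒢_θ`, DISCHARGED ([SemiAnbd] Thm 3.7 (iii) p. 41; [IUTchI] Rmk. 2.5.3 (i))

Mochizuki, *Semi-graphs of anabelioids*, Publ. RIMS **42** (2006), §3, Thm. 3.7 (iii) p. 41
[cite: MochizukiSemiAnbd2006, Thm 3.7(iii) p.41]; [IUTchI] Rmk. 2.5.3 (i) (T2)/(T4)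
[cite: Mochizuki2012, IUTchI Rem. 2.5.3(i)(T4) p.53].

PROOF-ONLY file (no definitions), FRONTIER programme SUBDAG-REFUTE-F1732 of cell abc-iut (towards a kernel
erratum for the ∀-countable reading of Thm. 3.7 (iii); print proves the finite-semi-graph statement, kernel
`compactInVerticialAt_of_finiteGraph`; IUT uses finite dual semi-graphs).  abc-iut-L3-d4's closing theorem
`thetaRay_not_compactInVerticial_of_characters` (p441714, `ThetaRayCritical.lean`) takes the binder

  `hK : ∀ n, ∃ j₀, ∀ j ≥ j₀, ∀ (w : ℕ) (P : PointSeq … w) (x : G), P.gal j x = 1 → ab n x = 1`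

("the level kernels of the decomposition homomorphisms lie in the kernels of the abelianisations `ab n`").
This file PRODUCES it (seat abc-iut-L3-t6, lineage DECOMP): for every ray of groups `thetaRay G E up low`
satisfying the hypotheses of Prop. 3.6 and STRICTLY COHERENT, and every family `ab n : G →* V n` of
homomorphisms with OPEN kernels of FINITE index, by abc-iut-L3-t6's
`exists_level_gal_eq_one_ker_of_index_le` (p438629: cofinality of the canonical tower of Prop. 3.6 on finite
coverings + abc-iut-w4-d075's covering `F_K` of (T4), p433539) — `thetaRay_hK_of_finiteIndex`; and at the free
pro-`p` model `𝒢_θ = thetaRayOfTwists F̂₂⁽ᵖ⁾ ℤ_p α θ n` with `ab n := abMod (e n)` (abc-iut-w6-d019, R1 part 3,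
p438627/p440035: open kernel of index `p^{2e}`) and strict coherence from abc-iut-w4-d075's R4c
`thetaRayFreeProP_isStrictlyCoherent` (p439988) — `thetaRayFreeProP_hK`, binder shape VERBATIM.
Nothing here bears on [IUTchIII] Cor. 3.12.
-/

noncomputable section

namespace Literature.AnabelianGeometry.SemiGraphs

open Topology Multiplicative
open ProfiniteSemiGraph ProfiniteSemiGraph.GaloisLevelData
open Literature.AnabelianGeometry.SemiGraphs.FreeProPRankTwo

/-! ### Generic ray of groups -/

section Generic

variable {G E : Type} [Group G] [TopologicalSpace G] [IsTopologicalGroup G] [CompactSpace G]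
  [TotallyDisconnectedSpace G] [Group E] [TopologicalSpace E] [IsTopologicalGroup E] [CompactSpace E]
  [TotallyDisconnectedSpace E] {up : E →ₜ* G} {low : ℕ → (E →ₜ* G)}
  {V : ℕ → Type} [∀ n, Group (V n)]

/-- **(hK) for a strictly coherent ray of groups**, in the binder shape of abc-iut-L3-d4's
`thetaRay_hcrit_of_characters` / `thetaRay_not_compactInVerticial_of_characters`: for every family
`ab n : G →* V n` with open kernels of finite index there are levels `j₀(n)` beyond which every level-`j`
kernel of every decomposition homomorphism at every vertex lies in `ker (ab n)`.
[cite: Mochizuki2012, IUTchI Rem. 2.5.3(i)(T4) p.53] -/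
theorem thetaRay_hK_of_finiteIndex (h36 : (thetaRay G E up low).Prop36Hypotheses)
    (hsc : (thetaRay G E up low).IsStrictlyCoherent) (ab : ∀ n, G →* V n)
    (hopen : ∀ n, IsOpen ((ab n).ker : Set G)) (hfin : ∀ n, (ab n).ker.index ≠ 0) :
    ∀ n : ℕ, ∃ j₀ : ℕ, ∀ j, j₀ ≤ j → ∀ (w : ℕ)
      (P : ((thetaRay G E up low).galoisLevelData h36).PointSeq h36.isCountable w) (x : G),
      P.gal j x = 1 → ab n x = 1 := by
  intro n
  obtain ⟨j₀, hj₀⟩ :=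
    (thetaRay G E up low).exists_level_gal_eq_one_ker_of_index_le h36 hsc (ab n).ker.index
  exact ⟨j₀, fun j hj w P x hx => hj₀ j hj w P (ab n) (hopen n) (hfin n) le_rfl x hx⟩

end Generic

/-! ### The free pro-`p` model `𝒢_θ` -/

section Model

variable (p : ℕ) [hp : Fact p.Prime]
variable (α : Multiplicative ℤ_[p] →ₜ* Grp p) (hα1 : α (ofAdd 1) = a p)
variable (θ : ℕ → (Grp p →ₜ* Grp p)) (hθ : ∀ m, Function.Bijective (θ m)) (n : ℕ → ℕ)

include hα1 hθ in
/-- **(hK) at `𝒢_θ` with `ab n := abMod (e n)`** — the binder of `thetaRay_not_compactInVerticial_of_characters`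
VERBATIM, for every exponent schedule `e : ℕ → ℕ`: beyond a level `j₀(n)`, `σ_j^x = 1 ⇒ abMod (e n) x = 1`
for every vertex `w`, point sequence `P` over `w` and `x ∈ F̂₂⁽ᵖ⁾`.
[cite: MochizukiSemiAnbd2006, Thm 3.7(iii) p.41] -/
theorem thetaRayFreeProP_hK
    (h36 : (thetaRayOfTwists (Grp p) (Multiplicative ℤ_[p]) α θ n).Prop36Hypotheses) (e : ℕ → ℕ) :
    ∀ m : ℕ, ∃ j₀ : ℕ, ∀ j, j₀ ≤ j → ∀ (w : ℕ)
      (P : ((thetaRayOfTwists (Grp p) (Multiplicative ℤ_[p]) α θ n).galoisLevelData h36).PointSeq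
        h36.isCountable w) (x : Grp p),
      P.gal j x = 1 → abMod p (e m) x = 1 := by
  intro m
  obtain ⟨j₀, hj₀⟩ :=
    (thetaRayOfTwists (Grp p) (Multiplicative ℤ_[p]) α θ n).exists_level_gal_eq_one_ker_of_index_le h36
      (thetaRayFreeProP_isStrictlyCoherent p α hα1 θ hθ n) (p ^ (2 * e m))
  exact ⟨j₀, fun j hj w P x hx => hj₀ j hj w P (abMod p (e m)).toMonoidHom (isOpen_ker_abMod p (e m))
    (ne_of_eq_of_ne (index_ker_abMod p (e m)) (pow_ne_zero _ hp.out.ne_zero))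
    (le_of_eq (index_ker_abMod p (e m))) x hx⟩

include hα1 hθ in
/-- The same with a CONSTANT exponent `e` (the shape `ab n := abMod e` for all `n`).
[cite: MochizukiSemiAnbd2006, Thm 3.7(iii) p.41] -/
theorem thetaRayFreeProP_hK_const
    (h36 : (thetaRayOfTwists (Grp p) (Multiplicative ℤ_[p]) α θ n).Prop36Hypotheses) (e : ℕ) :
    ∃ j₀ : ℕ, ∀ j, j₀ ≤ j → ∀ (w : ℕ)
      (P : ((thetaRayOfTwists (Grp p) (Multiplicative ℤ_[p]) α θ n).galoisLevelData h36).PointSeq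
        h36.isCountable w) (x : Grp p),
      P.gal j x = 1 → abMod p e x = 1 :=
  thetaRayFreeProP_hK p α hα1 θ hθ n h36 (fun _ => e) 0

end Model

end Literature.AnabelianGeometry.SemiGraphs

end
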